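import Summits.PneNP.PneNP.Theorems.SymmetryBudgetNoHiddenOrderProgramSrcsA

/-!
# `NoHiddenOrder` (stmt-PneNP-14781), (R2c) VI: the window canoniser program — local levels of the small shapes

Route `PneNP/SymmetryBudget`; companion of `…ProgramSrcsA.lean` (seat -1).  The `rank`/`rank_lt` fields of the assembled `SymProg` need,
shape by shape, a LOCAL LEVEL under which every source of a gate is either an internal gate of strictly smaller level or an INPUT wire of
the shape (to be placed below the shape's offset by the dispatch).  This file gives them for the counting and refinement shapes of
`…ProgramSrcsA.lean`, parametric in the inputs and the embedding: `ccLvl`/`ccSrcs_lvl`, `ctLvl`/`ctSrcs_lvl`, `riLvl`/`riSrcs_lvl` (rounds at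
stride `12`, the value read-out above round `wn m`; inputs `RIIn.IsInput`; also `riLtW_cases`/`riEqW_cases` for modules reading the
refinement's outputs), with the bounds `ccLvl_le` (`≤ 3`), `ctLvl_le` (`≤ 3`), `riLvl_le` (`≤ 12·wn m + 4`).  The `VecCmp` shapes are in
`…ProgramLvlsA2.lean`.  Sorry-free; supports stmt-PneNP-14781, does not close it.
-/

set_option linter.dupNamespace false -- `Summit.PneNP.PneNP.…` (D-0017 single-conjunct layout)

namespace Summit.PneNP.PneNP.Theorems

open Finset Literature.Computability.Complexity Literature.Computability.Complexity.SymProg CGBits BranchSum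

namespace WCanon

variable {m : ℕ}

/-- Introducing the "internal source of smaller level" alternative. [folklore] -/
theorem lvl_inl {X : Type*} {e : X → Gt m} {lvl : X → ℕ} {g g' : X} (h : lvl g' < lvl g) {Q : Prop} :
    (∃ g'', (Sum.inr (e g') : Wire m) = Sum.inr (e g'') ∧ lvl g'' < lvl g) ∨ Q :=
  Or.inl ⟨g', rfl, h⟩

/-! ### `CmpCount` and `CmpTwice` -/

/-- Local level of a `CmpCount` shape. [folklore] -/
def ccLvl : CCGate m → ℕ
  | .geA _ => 0
  | .geB _ => 0
  | .ngeA _ => 1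
  | .both _ => 1
  | .none _ => 1
  | .eqv _ => 2
  | .eq => 3
  | .ltw _ => 2
  | .lt => 3

/-- `ccLvl ≤ 3`. [folklore] -/
theorem ccLvl_le (g : CCGate m) : ccLvl g ≤ 3 := by
  cases g <;> simp [ccLvl]

/-- **Sources of a `CmpCount` shape are internal of smaller level, or inputs.** [folklore] -/
theorem ccSrcs_lvl {A B : Finset (Wire m)} {e : CCGate m → Gt m} {g : CCGate m} {w : Wire m} (hw : w ∈ ccSrcs A B e g) :
    (∃ g', w = Sum.inr (e g') ∧ ccLvl g' < ccLvl g) ∨ (w ∈ A ∨ w ∈ B) := by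
  cases g with
  | geA θ => exact Or.inr (Or.inl hw)
  | geB θ => exact Or.inr (Or.inr hw)
  | ngeA θ =>
    simp only [ccSrcs, mem_singleton] at hw
    rcases hw with rfl
    exact lvl_inl (by simp [ccLvl])
  | both θ =>
    simp only [ccSrcs, mem_insert, mem_singleton] at hw
    rcases hw with rfl | rfl <;> exact lvl_inl (by simp [ccLvl])
  | none θ =>
    simp only [ccSrcs, mem_insert, mem_singleton] at hw
    rcases hw with rfl | rfl <;> exact lvl_inl (by simp [ccLvl])
  | eqv θ =>
    simp only [ccSrcs, mem_insert, mem_singleton] at hw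
    rcases hw with rfl | rfl <;> exact lvl_inl (by simp [ccLvl])
  | eq =>
    simp only [ccSrcs, mem_image, mem_univ, true_and] at hw
    obtain ⟨θ, rfl⟩ := hw
    exact lvl_inl (by simp [ccLvl])
  | ltw θ =>
    simp only [ccSrcs, mem_insert, mem_singleton] at hw
    rcases hw with rfl | rfl <;> exact lvl_inl (by simp [ccLvl])
  | lt =>
    simp only [ccSrcs, mem_image, mem_univ, true_and] at hw
    obtain ⟨θ, rfl⟩ := hw
    exact lvl_inl (by simp [ccLvl])

/-- Local level of a `CmpTwice` shape. [folklore] -/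
def ctLvl : CTGate m → ℕ
  | .ge2A _ => 0
  | .geB _ => 0
  | .nge2A _ => 1
  | .tww _ => 2
  | .tw => 3

/-- `ctLvl ≤ 3`. [folklore] -/
theorem ctLvl_le (g : CTGate m) : ctLvl g ≤ 3 := by
  cases g <;> simp [ctLvl]

/-- **Sources of a `CmpTwice` shape are internal of smaller level, or inputs.** [folklore] -/
theorem ctSrcs_lvl {A B : Finset (Wire m)} {e : CTGate m → Gt m} {g : CTGate m} {w : Wire m} (hw : w ∈ ctSrcs A B e g) :
    (∃ g', w = Sum.inr (e g') ∧ ctLvl g' < ctLvl g) ∨ (w ∈ A ∨ w ∈ B) := by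
  cases g with
  | ge2A θ => exact Or.inr (Or.inl hw)
  | geB θ => exact Or.inr (Or.inr hw)
  | nge2A θ =>
    simp only [ctSrcs, mem_singleton] at hw
    rcases hw with rfl
    exact lvl_inl (by simp [ctLvl])
  | tww θ =>
    simp only [ctSrcs, mem_insert, mem_singleton] at hw
    rcases hw with rfl | rfl <;> exact lvl_inl (by simp [ctLvl])
  | tw =>
    simp only [ctSrcs, mem_image, mem_filter, mem_univ, true_and] at hw
    obtain ⟨θ, -, rfl⟩ := hw
    exact lvl_inl (by simp [ctLvl])

/-! ### `RefineIter` with value read-out -/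

/-- Local level of a refinement shape: round `r` occupies `[12r, 12r + 12)`, the value read-out sits above round `wn m`. [folklore] -/
def riLvl : RIGate m → ℕ
  | .c r _ _ _ => 12 * r
  | .cmp r _ _ _ g => 12 * r + 1 + ccLvl g
  | .nmem _ => 0
  | .nlt r _ _ => 12 * r
  | .pre r _ _ _ _ => 12 * r + 5
  | .allpre r _ _ _ => 12 * r + 6
  | .wit r _ _ _ => 12 * r + 7
  | .prof r _ _ => 12 * r + 8
  | .tie r _ _ => 12 * r + 9
  | .ltS r _ _ => 12 * r + 10
  | .eqS r _ _ => 12 * r + 11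
  | .vc _ _ => 12 * wn m
  | .vge _ _ => 12 * wn m + 1
  | .vnge _ _ => 12 * wn m + 2
  | .vinA _ _ => 12 * wn m + 3
  | .vnm _ => 0
  | .vval _ _ => 12 * wn m + 4

/-- `riLvl ≤ 12·wn m + 4`. [folklore] -/
theorem riLvl_le (g : RIGate m) : riLvl g ≤ 12 * wn m + 4 := by
  cases g <;> simp only [riLvl] <;> (try have := ccLvl_le ‹CCGate m›) <;> omega

/-- The INPUT wires of a refinement site. -/
def RIIn.IsInput (ι : RIIn m) (w : Wire m) : Prop :=
  (∃ y, w = ι.mem y) ∨ (∃ u y, w = ι.adj u y) ∨ (∃ u v, w = ι.lt0 u v) ∨ (∃ u v, w = ι.eq0 u v)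

/-- The order wire entering round `r` is the input order or an internal `ltS` of round `r - 1`. [folklore] -/
theorem riLtW_cases (ι : RIIn m) (e : RIGate m → Gt m) (r : Fin (wn m + 1)) (u v : WV m) :
    riLtW ι e r u v = ι.lt0 u v ∨ ((r : ℕ) ≠ 0 ∧ ∃ h : (r : ℕ) - 1 < wn m, riLtW ι e r u v = Sum.inr (e (.ltS ⟨r - 1, h⟩ u v))) := by
  unfold riLtW
  split_ifs with h
  · exact Or.inl rfl
  · exact Or.inr ⟨h, ⟨by omega, rfl⟩⟩

/-- The kernel wire entering round `r` is the input kernel or an internal `eqS` of round `r - 1`. [folklore] -/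
theorem riEqW_cases (ι : RIIn m) (e : RIGate m → Gt m) (r : Fin (wn m + 1)) (u v : WV m) :
    riEqW ι e r u v = ι.eq0 u v ∨ ((r : ℕ) ≠ 0 ∧ ∃ h : (r : ℕ) - 1 < wn m, riEqW ι e r u v = Sum.inr (e (.eqS ⟨r - 1, h⟩ u v))) := by
  unfold riEqW
  split_ifs with h
  · exact Or.inl rfl
  · exact Or.inr ⟨h, ⟨by omega, rfl⟩⟩

/-- **Sources of a refinement shape are internal of smaller level, or inputs.** [folklore] -/
theorem riSrcs_lvl {ι : RIIn m} {e : RIGate m → Gt m} {g : RIGate m} {w : Wire m} (hw : w ∈ riSrcs ι e g) :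
    (∃ g', w = Sum.inr (e g') ∧ riLvl g' < riLvl g) ∨ ι.IsInput w := by
  cases g with
  | c r u w' y =>
    by_cases hr : (r : ℕ) = 0
    · simp only [riSrcs, hr, ↓reduceDIte, mem_insert, mem_singleton] at hw
      rcases hw with rfl | rfl | rfl
      · exact Or.inr (Or.inl ⟨_, rfl⟩)
      · exact Or.inr (Or.inr (Or.inl ⟨_, _, rfl⟩))
      · exact Or.inr (Or.inr (Or.inr (Or.inr ⟨_, _, rfl⟩)))
    · simp only [riSrcs, hr, ↓reduceDIte, mem_insert, mem_singleton] at hw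
      rcases hw with rfl | rfl | rfl
      · exact Or.inr (Or.inl ⟨_, rfl⟩)
      · exact Or.inr (Or.inr (Or.inl ⟨_, _, rfl⟩))
      · exact lvl_inl (by simp only [riLvl]; omega)
  | cmp r u v w' g =>
    simp only [riSrcs] at hw
    rcases ccSrcs_lvl hw with ⟨g', rfl, hl⟩ | hA | hB
    · exact lvl_inl (by simp only [riLvl]; omega)
    · simp only [mem_image, mem_univ, true_and] at hA
      obtain ⟨y, rfl⟩ := hA
      exact lvl_inl (by simp only [riLvl]; omega)
    · simp only [mem_image, mem_univ, true_and] at hB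
      obtain ⟨y, rfl⟩ := hB
      exact lvl_inl (by simp only [riLvl]; omega)
  | nmem w' =>
    simp only [riSrcs, mem_singleton] at hw
    rcases hw with rfl
    exact Or.inr (Or.inl ⟨_, rfl⟩)
  | nlt r w' w'' =>
    by_cases hr : (r : ℕ) = 0
    · simp only [riSrcs, hr, ↓reduceDIte, mem_singleton] at hw
      rcases hw with rfl
      exact Or.inr (Or.inr (Or.inr (Or.inl ⟨_, _, rfl⟩)))
    · simp only [riSrcs, hr, ↓reduceDIte, mem_singleton] at hw
      rcases hw with rfl
      exact lvl_inl (by simp only [riLvl]; omega)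
  | pre r u v w' w'' =>
    simp only [riSrcs, mem_insert, mem_singleton] at hw
    rcases hw with rfl | rfl | rfl <;> exact lvl_inl (by simp only [riLvl, ccLvl]; omega)
  | allpre r u v w' =>
    simp only [riSrcs, mem_image, mem_univ, true_and] at hw
    obtain ⟨y, rfl⟩ := hw
    exact lvl_inl (by simp only [riLvl]; omega)
  | wit r u v w' =>
    simp only [riSrcs, mem_insert, mem_singleton] at hw
    rcases hw with rfl | rfl | rfl
    · exact Or.inr (Or.inl ⟨_, rfl⟩)
    · exact lvl_inl (by simp only [riLvl, ccLvl]; omega)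
    · exact lvl_inl (by simp only [riLvl]; omega)
  | prof r u v =>
    simp only [riSrcs, mem_image, mem_univ, true_and] at hw
    obtain ⟨y, rfl⟩ := hw
    exact lvl_inl (by simp only [riLvl]; omega)
  | tie r u v =>
    by_cases hr : (r : ℕ) = 0
    · simp only [riSrcs, hr, ↓reduceDIte, mem_insert, mem_singleton] at hw
      rcases hw with rfl | rfl
      · exact Or.inr (Or.inr (Or.inr (Or.inr ⟨_, _, rfl⟩)))
      · exact lvl_inl (by simp only [riLvl]; omega)
    · simp only [riSrcs, hr, ↓reduceDIte, mem_insert, mem_singleton] at hw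
      rcases hw with rfl | rfl <;> exact lvl_inl (by simp only [riLvl]; omega)
  | ltS r u v =>
    by_cases hr : (r : ℕ) = 0
    · simp only [riSrcs, hr, ↓reduceDIte, mem_insert, mem_singleton] at hw
      rcases hw with rfl | rfl
      · exact Or.inr (Or.inr (Or.inr (Or.inl ⟨_, _, rfl⟩)))
      · exact lvl_inl (by simp only [riLvl]; omega)
    · simp only [riSrcs, hr, ↓reduceDIte, mem_insert, mem_singleton] at hw
      rcases hw with rfl | rfl <;> exact lvl_inl (by simp only [riLvl]; omega)
  | eqS r u v =>
    simp only [riSrcs, mem_insert, mem_singleton] at hw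
    rcases hw with rfl | rfl <;> exact lvl_inl (by simp only [riLvl]; omega)
  | vc w' v =>
    simp only [riSrcs, mem_insert, mem_singleton] at hw
    rcases hw with rfl | rfl
    · exact Or.inr (Or.inl ⟨_, rfl⟩)
    · rcases riLtW_cases ι e (Fin.last (wn m)) w' v with h | ⟨hT, hlt, h⟩
      · rw [h]; exact Or.inr (Or.inr (Or.inr (Or.inl ⟨_, _, rfl⟩)))
      · rw [h]
        simp only [Fin.val_last] at hT ⊢
        exact lvl_inl (by simp only [riLvl]; omega)
  | vge v t =>
    simp only [riSrcs, mem_image, mem_univ, true_and] at hw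
    obtain ⟨y, rfl⟩ := hw
    exact lvl_inl (by simp only [riLvl]; omega)
  | vnge v t =>
    simp only [riSrcs, mem_singleton] at hw
    rcases hw with rfl
    exact lvl_inl (by simp only [riLvl]; omega)
  | vinA v t =>
    simp only [riSrcs, mem_insert, mem_singleton] at hw
    rcases hw with rfl | rfl | rfl
    · exact Or.inr (Or.inl ⟨_, rfl⟩)
    · exact lvl_inl (by simp only [riLvl]; omega)
    · exact lvl_inl (by simp only [riLvl]; omega)
  | vnm v =>
    simp only [riSrcs, mem_singleton] at hw
    rcases hw with rfl
    exact Or.inr (Or.inl ⟨_, rfl⟩)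
  | vval v t =>
    by_cases ht : (t : ℕ) = 0
    · simp only [riSrcs, ht, ↓reduceIte, mem_insert, mem_singleton] at hw
      rcases hw with rfl | rfl <;> exact lvl_inl (by simp only [riLvl]; omega)
    · simp only [riSrcs, ht, ↓reduceIte, mem_singleton] at hw
      rcases hw with rfl
      exact lvl_inl (by simp only [riLvl]; omega)

end WCanon

end Summit.PneNP.PneNP.Theorems
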